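import Summits.Langlands.Langlands.Theorems.IrreducibilityBySelfDualityHeckeEigenvalueFieldBorelSerre
import Summits.Langlands.Langlands.Theorems.IrreducibilityBySelfDualityHeckeEigenvalueFieldResComparison
import Summits.Langlands.Langlands.Theorems.IrreducibilityBySelfDualityHeckeEigenvalueFieldResClosure
import Literature.NumberTheory.Automorphic.ClozelAlgebraicityHeckeFieldResComparisonProofs
import Literature.NumberTheory.Automorphic.ResGLnCuspidalEigenclassOfRealisationFull
import Literature.NumberTheory.Automorphic.AutomorphicRepsGLSatakeProofs
import Literature.NumberTheory.Automorphic.AutomorphicRepsGLSatakeFlathProofs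
import HarnessLib

/-!
# Crux `HeckeEigenvalueField` (stmt-Langlands-13632), line `Sketch`: the closures with Borel–Serre
# DISCHARGED — the crux modulo the single apex A′

With `borelSerre1973_finiteDimensional_groupCohomology_congruenceSubgroup_holds`
(`…HeckeEigenvalueFieldBorelSerre`, the B programme of line `Sketch` composed) the Borel–Serre
hypothesis disappears from every conditional closure of the crux landed so far (the finite-coefficient
twin is `borelSerre1973_finite_groupCohomology_congruenceSubgroup_holds`,
`…HeckeEigenvalueFieldBorelSerreFinite`).  This file records:

* `clozel1990_heckeEigenvalueField_of_cuspidalEigenclass` /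
  `HeckeEigenvalueField_of_cuspidalEigenclass` — Clozel's Hecke-field theorem (the Literature named
  fact `Clozel1990_heckeEigenvalueField`, = the route decl) from the cuspidal-eigenclass fact
  `ResGLnCohomology.cuspidalEigenclass_exists` ALONE;
* `clozel1990_heckeEigenvalueField_of_eigenformComparison_rank_two` /
  `HeckeEigenvalueField_of_eigenformComparison_rank_two` — the same from the registered stub A′ of
  line `Sketch` alone (the Eichler–Shimura–Borel comparison for one spherical eigenform, `n ≥ 2`);
* `clozel1990_heckeEigenvalueField_of_realisationFull` / `HeckeEigenvalueField_of_realisationFull`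
  — the same from the printed realisation theorem (R′) of `ResGLnCuspidalEigenclassOfRealisationFull`
  (a non-zero Hecke-equivariant map `H^q(𝔤, K_∞; π ⊗ (E_λ ⊗ ε_S)) → H^q(GL_n(K), Fun ⊗ (E_λ ⊗ ε_S))`
  on the `K_f(𝔫)`-invariant classes) alone;
* `eigenformComparison_rank_two_of_cuspidalEigenclass` — conversely stub A′ FOLLOWS from the fact
  (A′ ⟺ the `n ≥ 2` slice of `ResGLnCohomology.cuspidalEigenclass_exists` over the tree);
* `clozel1990_ratField_numberField_of_eigenformComparison_rank_two` — clause (i) of Clozel's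
  Thm. 3.13 (`ℚ(π_f)` is a number field) from A′ alone.

So the crux is closed CONDITIONALLY on exactly one published theorem absent from the tree: the
Betti realisation of cohomological cuspidal representations (Clozel Lemme 3.15 / Borel–Wallach VII /
Borel's regularization), in any of the three interchangeable shapes above.

## References

* L. Clozel, *Motifs et formes automorphes* (1990), Thm. 3.13, Lemme 3.14–3.15, §3.5 [Clozel1990].
* A. Borel, J.-P. Serre, Comment. Math. Helv. 48 (1973), §11.1, Thm. 11.4.4 [BorelSerre1973].
* A. Borel, N. Wallach (2000), VII 2.5–2.7 [BorelWallach2000].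
* A. Borel, Duke Math. J. 50 (1983), Thm. 5.3, Cor. 5.5 [Borel1983Regularization].
-/

noncomputable section

set_option linter.dupNamespace false -- project-wide: `Summit.Langlands.Langlands` is the mandated namespace

open scoped Classical
open NumberField IsDedekindDomain CategoryTheory
open Literature.NumberTheory.Automorphic Literature.NumberTheory.DiophantineGeometry Literature.Barriers.Langlands

namespace Summit.Langlands.Langlands.Theorems.HeckeEigenvalueField.Res

open ResGLnCohomology BigHeckeGLn

/-! ## The crux from the cuspidal-eigenclass fact alone -/

/-- **Clozel's Hecke-field theorem from the cuspidal-eigenclass fact alone**: the Literature named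
fact `Clozel1990_heckeEigenvalueField` follows from `ResGLnCohomology.cuspidalEigenclass_exists`,
Borel–Serre being a theorem (`borelSerre1973_finiteDimensional_groupCohomology_congruenceSubgroup_holds`).
[cite: Clozel1990, Thm. 3.13 (proof, §3.5 pp. 120–123)] -/
theorem clozel1990_heckeEigenvalueField_of_cuspidalEigenclass
    (hA : ResGLnCohomology.cuspidalEigenclass_exists) : Clozel1990_heckeEigenvalueField :=
  Clozel1990_heckeEigenvalueField_of_cuspidalEigenclass_of_borelSerre hA
    borelSerre1973_finiteDimensional_groupCohomology_congruenceSubgroup_holds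

/-- **The route decl `IrreducibilityBySelfDuality.HeckeEigenvalueField` BY NAME from the
cuspidal-eigenclass fact alone** (conditional closure of stmt-Langlands-13632: the only remaining
input is `ResGLnCohomology.cuspidalEigenclass_exists`). [cite: Clozel1990, Thm. 3.13] -/
theorem HeckeEigenvalueField_of_cuspidalEigenclass :
    ResGLnCohomology.cuspidalEigenclass_exists →
      Summit.Langlands.Langlands.Theses.IrreducibilityBySelfDuality.HeckeEigenvalueField :=
  fun hA => HeckeEigenvalueField_of_cuspidalEigenclass_of_borelSerre hA
    borelSerre1973_finiteDimensional_groupCohomology_congruenceSubgroup_holds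

/-! ## The crux from the registered stub A′ (comparison for one spherical eigenform, `n ≥ 2`) alone -/

/-- **Clozel's Hecke-field theorem from stub A′ alone** (the comparison half of the
cuspidal-eigenclass fact for `n ≥ 2`; rank one is the theorem
`ResGLnCohomology.cuspidalEigenclass_exists_rank_one`, Borel–Serre is a theorem).
[cite: Clozel1990, Thm. 3.13, Lemme 3.15 and §3.5] -/
theorem clozel1990_heckeEigenvalueField_of_eigenformComparison_rank_two
    (hC : ∀ (n : ℕ) (K : Type) [Field K] [NumberField K] (hcpt : isCompact_glFiniteIntegralLevel n K)
      (𝔫 : Ideal (𝓞 K)) (lam : (K →+* ℂ) → Fin n → ℤ), 2 ≤ n → 𝔫 ≠ 0 →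
      (∀ τ, Weight.IsDominant (lam τ)) →
      ∀ π : CuspidalAutomorphicRepData n K hcpt,
        (∃ T : InfinityType K n, π.1.HasInfinityType T ∧
          ∀ τ : K →+* ℂ, (T τ).map ArchWeight.a =
            (cohomologicalInfinityType n K (Weight.dual (lam τ)) τ).map ArchWeight.a) →
        ∀ φ ∈ π.1.W, φ ∉ π.1.W' →
          (∀ u ∈ principalCongruenceLevel n K 𝔫,
            rightTranslation (AdelicGroupData.gl n K) u φ = φ) →
          ∀ c : HeightOneSpectrum (𝓞 K) → ℕ → ℂ,
            (∀ v : HeightOneSpectrum (𝓞 K), ¬ v.asIdeal ∣ 𝔫 → ∀ i ≤ n,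
              heckeOperator (rightTranslation (AdelicGroupData.gl n K))
                  (principalCongruenceLevel n K 𝔫)
                  (heckeDiagAt n K v (uniformizerAt v) i) φ - c v i • φ ∈ π.1.W') →
            ∃ (q : ℕ) (x : levelCohomology ℂ n K 𝔫 lam q), x ≠ 0 ∧
              ∀ v : HeightOneSpectrum (𝓞 K), ¬ v.asIdeal ∣ 𝔫 → ∀ i ≤ n,
                heckeT ℂ n K 𝔫 lam q v i x = c v i • x) :
    Clozel1990_heckeEigenvalueField :=
  clozel1990_heckeEigenvalueField_of_eigenformComparison_rank_two_of_borelSerre hC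
    borelSerre1973_finiteDimensional_groupCohomology_congruenceSubgroup_holds

/-- **Clause (i) of Clozel's Thm. 3.13 (`ℚ(π_f)` is a number field) from stub A′ alone.**
[cite: Clozel1990, Thm. 3.13 (i) (proof, §3.5)] -/
theorem clozel1990_ratField_numberField_of_eigenformComparison_rank_two
    (hC : ∀ (n : ℕ) (K : Type) [Field K] [NumberField K] (hcpt : isCompact_glFiniteIntegralLevel n K)
      (𝔫 : Ideal (𝓞 K)) (lam : (K →+* ℂ) → Fin n → ℤ), 2 ≤ n → 𝔫 ≠ 0 →
      (∀ τ, Weight.IsDominant (lam τ)) →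
      ∀ π : CuspidalAutomorphicRepData n K hcpt,
        (∃ T : InfinityType K n, π.1.HasInfinityType T ∧
          ∀ τ : K →+* ℂ, (T τ).map ArchWeight.a =
            (cohomologicalInfinityType n K (Weight.dual (lam τ)) τ).map ArchWeight.a) →
        ∀ φ ∈ π.1.W, φ ∉ π.1.W' →
          (∀ u ∈ principalCongruenceLevel n K 𝔫,
            rightTranslation (AdelicGroupData.gl n K) u φ = φ) →
          ∀ c : HeightOneSpectrum (𝓞 K) → ℕ → ℂ,
            (∀ v : HeightOneSpectrum (𝓞 K), ¬ v.asIdeal ∣ 𝔫 → ∀ i ≤ n,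
              heckeOperator (rightTranslation (AdelicGroupData.gl n K))
                  (principalCongruenceLevel n K 𝔫)
                  (heckeDiagAt n K v (uniformizerAt v) i) φ - c v i • φ ∈ π.1.W') →
            ∃ (q : ℕ) (x : levelCohomology ℂ n K 𝔫 lam q), x ≠ 0 ∧
              ∀ v : HeightOneSpectrum (𝓞 K), ¬ v.asIdeal ∣ 𝔫 → ∀ i ≤ n,
                heckeT ℂ n K 𝔫 lam q v i x = c v i • x) :
    Clozel1990_ratField_numberField :=
  Clozel1990_ratField_numberField_of_eigenformComparison_rank_two_of_borelSerre hC
    borelSerre1973_finiteDimensional_groupCohomology_congruenceSubgroup_holds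

/-- **The route decl `IrreducibilityBySelfDuality.HeckeEigenvalueField` BY NAME from stub A′
alone** (conditional closure of stmt-Langlands-13632 along line `Sketch`, v8: every other stub
landed). [cite: Clozel1990, Thm. 3.13] -/
theorem HeckeEigenvalueField_of_eigenformComparison_rank_two
    (hC : ∀ (n : ℕ) (K : Type) [Field K] [NumberField K] (hcpt : isCompact_glFiniteIntegralLevel n K)
      (𝔫 : Ideal (𝓞 K)) (lam : (K →+* ℂ) → Fin n → ℤ), 2 ≤ n → 𝔫 ≠ 0 →
      (∀ τ, Weight.IsDominant (lam τ)) →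
      ∀ π : CuspidalAutomorphicRepData n K hcpt,
        (∃ T : InfinityType K n, π.1.HasInfinityType T ∧
          ∀ τ : K →+* ℂ, (T τ).map ArchWeight.a =
            (cohomologicalInfinityType n K (Weight.dual (lam τ)) τ).map ArchWeight.a) →
        ∀ φ ∈ π.1.W, φ ∉ π.1.W' →
          (∀ u ∈ principalCongruenceLevel n K 𝔫,
            rightTranslation (AdelicGroupData.gl n K) u φ = φ) →
          ∀ c : HeightOneSpectrum (𝓞 K) → ℕ → ℂ,
            (∀ v : HeightOneSpectrum (𝓞 K), ¬ v.asIdeal ∣ 𝔫 → ∀ i ≤ n,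
              heckeOperator (rightTranslation (AdelicGroupData.gl n K))
                  (principalCongruenceLevel n K 𝔫)
                  (heckeDiagAt n K v (uniformizerAt v) i) φ - c v i • φ ∈ π.1.W') →
            ∃ (q : ℕ) (x : levelCohomology ℂ n K 𝔫 lam q), x ≠ 0 ∧
              ∀ v : HeightOneSpectrum (𝓞 K), ¬ v.asIdeal ∣ 𝔫 → ∀ i ≤ n,
                heckeT ℂ n K 𝔫 lam q v i x = c v i • x) :
    Summit.Langlands.Langlands.Theses.IrreducibilityBySelfDuality.HeckeEigenvalueField :=
  HeckeEigenvalueField_of_eigenformComparison_rank_two_of_borelSerre hC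
    borelSerre1973_finiteDimensional_groupCohomology_congruenceSubgroup_holds

/-! ## The registered stub A′ is implied by the cuspidal-eigenclass fact -/

/-- The fixed uniformiser `ϖ_v = BigHeckeGLn.uniformizerAt v` has valuation `exp (-1)`. [folklore] -/
private theorem resFinal_valued_uniformizerAt {K : Type} [Field K] [NumberField K]
    (v : HeightOneSpectrum (𝓞 K)) :
    Valued.v ((BigHeckeGLn.uniformizerAt v : (v.adicCompletion K)ˣ) : v.adicCompletion K) =
      WithZero.exp (-1 : ℤ) := by
  change Valued.v ((Classical.choose (v.valuation_exists_uniformizer K) : K) : v.adicCompletion K) = _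
  rw [HeightOneSpectrum.valuedAdicCompletion_eq_valuation']
  exact Classical.choose_spec (v.valuation_exists_uniformizer K)

/-- **Stub A′ follows from the cuspidal-eigenclass fact** (so the registered open stub of line
`Sketch` is EQUIVALENT, over the tree, to the `n ≥ 2` slice of the catalogued fact
`ResGLnCohomology.cuspidalEigenclass_exists`; the other direction is
`cuspidalEigenclass_rank_two_of_eigenformComparison`): the eigenclass of the fact has the
Satake–Tamagawa eigenvalues, and the scalar of `T_{v,i}(ϖ_v)` on a spherical eigenform modulo `W'`
IS that value (`HasSatakeParamAt.eq_esymm_of_sub_smul_mem`, Flath + Satake, theorems of the tree;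
a Satake parameter exists at `v ∤ 𝔫` by `hasSatakeParamAt_of_fixed`).
[cite: Clozel1990, Lemme 3.15 and §3.5] [cite: FlathCorvallis1979, Thm. 3] -/
theorem eigenformComparison_rank_two_of_cuspidalEigenclass
    (hA : ResGLnCohomology.cuspidalEigenclass_exists) :
    ∀ (n : ℕ) (K : Type) [Field K] [NumberField K] (hcpt : isCompact_glFiniteIntegralLevel n K)
      (𝔫 : Ideal (𝓞 K)) (lam : (K →+* ℂ) → Fin n → ℤ), 2 ≤ n → 𝔫 ≠ 0 →
      (∀ τ, Weight.IsDominant (lam τ)) →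
      ∀ π : CuspidalAutomorphicRepData n K hcpt,
        (∃ T : InfinityType K n, π.1.HasInfinityType T ∧
          ∀ τ : K →+* ℂ, (T τ).map ArchWeight.a =
            (cohomologicalInfinityType n K (Weight.dual (lam τ)) τ).map ArchWeight.a) →
        ∀ φ ∈ π.1.W, φ ∉ π.1.W' →
          (∀ u ∈ principalCongruenceLevel n K 𝔫,
            rightTranslation (AdelicGroupData.gl n K) u φ = φ) →
          ∀ c : HeightOneSpectrum (𝓞 K) → ℕ → ℂ,
            (∀ v : HeightOneSpectrum (𝓞 K), ¬ v.asIdeal ∣ 𝔫 → ∀ i ≤ n,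
              heckeOperator (rightTranslation (AdelicGroupData.gl n K))
                  (principalCongruenceLevel n K 𝔫)
                  (heckeDiagAt n K v (uniformizerAt v) i) φ - c v i • φ ∈ π.1.W') →
            ∃ (q : ℕ) (x : levelCohomology ℂ n K 𝔫 lam q), x ≠ 0 ∧
              ∀ v : HeightOneSpectrum (𝓞 K), ¬ v.asIdeal ∣ 𝔫 → ∀ i ≤ n,
                heckeT ℂ n K 𝔫 lam q v i x = c v i • x := by
  intro n K _ _ hcpt 𝔫 lam hn h𝔫 hdom π hT φ hφW hφW' hfix c hc
  obtain ⟨q, x, hx0, hxT⟩ := hA n K hcpt 𝔫 lam (by omega) h𝔫 hdom π hT ⟨φ, hφW, hφW', hfix⟩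
  have hS := π.1.Flath1979_heckeOperator_ofLocal_sub_smul_mem_holds
  refine ⟨q, x, hx0, fun v hv i hi => ?_⟩
  obtain ⟨α, hα⟩ := AutomorphicRepData.hasSatakeParamAt_of_fixed hS h𝔫 hv
    (resFinal_valued_uniformizerAt v) hφW hφW' hfix
  rw [hxT v hv α hα i hi, hα.eq_esymm_of_sub_smul_mem hS h𝔫 hv (resFinal_valued_uniformizerAt v)
    hφW hφW' hfix hi (hc v hv i hi)]
  rfl

/-! ## The crux from the printed realisation theorem (R′) alone -/

/-- **Clozel's Hecke-field theorem from the realisation theorem (R′) alone** — a non-zero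
Hecke-equivariant map `Φ' : H^q(𝔤, K_∞; π ⊗ (E_λ ⊗ ε_S)) → H^q(GL_n(K), Fun(GL_n(𝔸_K^∞)/K_f(𝔫), E_λ ⊗ ε_S))`
on the `K_f(𝔫)`-invariant classes, for every cuspidal `π` of cohomological type (Borel–Wallach
VII 2.7 with Borel's injectivity and Clozel's non-vanishing): the hypothesis of
`ResGLnCohomology.cuspidalEigenclass_exists_of_realisationFull`, Borel–Serre being a theorem.
[cite: Clozel1990, Thm. 3.13, Lemme 3.14–3.15, §3.5] [cite: BorelWallach2000, VII 2.5–2.7]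
[cite: Borel1983Regularization, Thm. 5.3 and Cor. 5.5] -/
theorem clozel1990_heckeEigenvalueField_of_realisationFull
    (hreal : ∀ (n : ℕ) (K : Type) [Field K] [NumberField K] (hcpt : isCompact_glFiniteIntegralLevel n K)
      (𝔫 : Ideal (𝓞 K)) (lam : (K →+* ℂ) → Fin n → ℤ), 1 ≤ n → 𝔫 ≠ 0 →
      (∀ τ, Weight.IsDominant (lam τ)) →
      ∀ π : CuspidalAutomorphicRepData n K hcpt,
        (∃ T : InfinityType K n, π.1.HasInfinityType T ∧
          ∀ τ : K →+* ℂ, (T τ).map ArchWeight.a =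
            (cohomologicalInfinityType n K (Weight.dual (lam τ)) τ).map ArchWeight.a) →
        (∃ φ ∈ π.1.W, φ ∉ π.1.W' ∧
          ∀ u ∈ principalCongruenceLevel n K 𝔫, rightTranslation (AdelicGroupData.gl n K) u φ = φ) →
        ∃ (S : Finset {w : InfinitePlace K // w.IsReal}) (q : ℕ)
          (Φ' : π.cohomologyLamSign S lam q →ₗ[ℂ] levelCohomologyTwist n K 𝔫 lam S q),
          (∀ v : HeightOneSpectrum (𝓞 K), ¬ v.asIdeal ∣ 𝔫 → ∀ i ≤ n,
            ∀ ξ ∈ π.cohomologyLamSignLevel S lam (level n K 𝔫) q,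
              Φ' (π.heckeTLamSign S lam (level n K 𝔫) q v i ξ) =
                heckeTTwist n K 𝔫 lam S q v i (Φ' ξ)) ∧
          ∃ ξ ∈ π.cohomologyLamSignLevel S lam (level n K 𝔫) q, Φ' ξ ≠ 0) :
    Clozel1990_heckeEigenvalueField :=
  clozel1990_heckeEigenvalueField_of_cuspidalEigenclass
    (cuspidalEigenclass_exists_of_realisationFull hreal)

/-- **The route decl `IrreducibilityBySelfDuality.HeckeEigenvalueField` BY NAME from the
realisation theorem (R′) alone.** [cite: Clozel1990, Thm. 3.13] [cite: BorelWallach2000, VII 2.7] -/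
theorem HeckeEigenvalueField_of_realisationFull
    (hreal : ∀ (n : ℕ) (K : Type) [Field K] [NumberField K] (hcpt : isCompact_glFiniteIntegralLevel n K)
      (𝔫 : Ideal (𝓞 K)) (lam : (K →+* ℂ) → Fin n → ℤ), 1 ≤ n → 𝔫 ≠ 0 →
      (∀ τ, Weight.IsDominant (lam τ)) →
      ∀ π : CuspidalAutomorphicRepData n K hcpt,
        (∃ T : InfinityType K n, π.1.HasInfinityType T ∧
          ∀ τ : K →+* ℂ, (T τ).map ArchWeight.a =
            (cohomologicalInfinityType n K (Weight.dual (lam τ)) τ).map ArchWeight.a) →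
        (∃ φ ∈ π.1.W, φ ∉ π.1.W' ∧
          ∀ u ∈ principalCongruenceLevel n K 𝔫, rightTranslation (AdelicGroupData.gl n K) u φ = φ) →
        ∃ (S : Finset {w : InfinitePlace K // w.IsReal}) (q : ℕ)
          (Φ' : π.cohomologyLamSign S lam q →ₗ[ℂ] levelCohomologyTwist n K 𝔫 lam S q),
          (∀ v : HeightOneSpectrum (𝓞 K), ¬ v.asIdeal ∣ 𝔫 → ∀ i ≤ n,
            ∀ ξ ∈ π.cohomologyLamSignLevel S lam (level n K 𝔫) q,
              Φ' (π.heckeTLamSign S lam (level n K 𝔫) q v i ξ) =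
                heckeTTwist n K 𝔫 lam S q v i (Φ' ξ)) ∧
          ∃ ξ ∈ π.cohomologyLamSignLevel S lam (level n K 𝔫) q, Φ' ξ ≠ 0) :
    Summit.Langlands.Langlands.Theses.IrreducibilityBySelfDuality.HeckeEigenvalueField :=
  HeckeEigenvalueField_of_cuspidalEigenclass (cuspidalEigenclass_exists_of_realisationFull hreal)

end Summit.Langlands.Langlands.Theorems.HeckeEigenvalueField.Res

end
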